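import Summits.CriticalPhenomena.SAWScalingLimit.Theses.SAWBrickWallHomotopy
import Literature.Probability.Percolation.CLE6
import Literature.Probability.RandomPlanarGeometry.SAWScalingLimitFamily
import Literature.Probability.RandomPlanarGeometry.SLEUniquenessInLaw
import Literature.Probability.RandomPlanarGeometry.ZoomFlow
import Literature.Probability.RandomPlanarGeometry.ConformalRestrictionProofs
import Literature.Probability.RandomPlanarGeometry.LocalMartingaleProofs

/-!
# Crux `HexTransfer` (stmt-CriticalPhenomena-14221), line `pin-the-shear`:
stub `stub_conjugateRotationCovariance`

Landing target:
`Summits/CriticalPhenomena/SAWScalingLimit/Theorems/SAWDevelopingMapHexTransferConjugateRotationCovariance.lean`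
(`--supports stmt-CriticalPhenomena-14221`).

Fix ONE plane homeomorphism `Φ`. Suppose that for every Dobrushin domain `D` and every endpoint
approximation `(a_δ, b_δ)` the critical `δℤ²` SAW law of `D` converges in law to `Φ ∘ Γ_D`, with
`Γ_D` a chordal SLE(8/3) curve of `Φ⁻¹(D)` (the "image limit"), and that the quarter turn
`R : z ↦ i z` is an exact symmetry of the critical `δℤ²` SAW laws and of endpoint approximations
(`SAWBrickWallHomotopy.QuarterTurnCovariance`, item stmt-CriticalPhenomena-5794, a hypothesis
here). Then `Ψ := Φ⁻¹ ∘ R ∘ Φ` (as a homeomorphism: `Φ.trans (R.trans Φ.symm)`) maps every chordal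
SLE(8/3) law to a chordal SLE(8/3) law: `IsSLELaw (8/3) D μ → IsSLELaw (8/3) (Ψ D) (Ψ_* μ)`.

Proof (pure measure-theoretic bookkeeping). Let `μ` be the law of an SLE(8/3) curve `Γ'` of `D`.
Put `E := Φ(D)` and pick an endpoint approximation `(a, b)` of `E` (`SAW.exists_isEndpointApprox`).
The image limit at `(E, a, b)` gives an SLE(8/3) curve `Γ` of `Φ⁻¹(E) = D` with
`SAW_δ(E) → Φ ∘ Γ` in law; the rotated approximation `(Ra, Rb)` of `R(E)` gives an SLE(8/3) curve
`Γ₂` of `Φ⁻¹(R(E)) = Ψ(D)` with `SAW_δ(R E) → Φ ∘ Γ₂`. Pushing the first limit along the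
continuous map `CurveClass.map R` and using the exact lattice symmetry (`SAW_δ(R E) = R_* SAW_δ(E)`)
yields `SAW_δ(R E) → R ∘ Φ ∘ Γ`; uniqueness of weak limits (`TendstoLaw.map_eq`) gives
`law (R ∘ Φ ∘ Γ) = law (Φ ∘ Γ₂)`, whence `law (Ψ ∘ Γ) = law Γ₂` after applying `Φ⁻¹`. Finally
`μ = law Γ' = law Γ` by uniqueness in law of chordal SLE (`IsSLECurve.map_eq_holds`), so
`Ψ_* μ = law (Ψ ∘ Γ) = law Γ₂` is the law of an SLE(8/3) curve of `Ψ(D)`.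

Sources: P. Billingsley, *Convergence of probability measures*, 2nd ed. (1999), Thm 1.2
(uniqueness of weak limits); G. F. Lawler, *Conformally invariant processes in the plane* (2005),
§6.3 (the chordal SLE law); tagged [folklore].
-/

noncomputable section

namespace Summit.CriticalPhenomena.SAWScalingLimit.Cruxes.HexTransfer.PinTheShear

open MeasureTheory Filter Topology Set
open scoped NNReal
open Literature.Probability.RandomPlanarGeometry
open Literature.Probability.LatticeModels (Site)
open Literature.Probability (Process.preWienerMeasure)
open Summit.CriticalPhenomena.SAWScalingLimit.Theses

/-! ### Two pieces of weak-limit bookkeeping -/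

/-- Convergence in law is preserved by composition with a continuous map (continuous mapping
theorem in its trivial, everywhere-continuous form: test functions compose,
`BoundedContinuousFunction.compContinuous`). [folklore] -/
theorem tendstoLaw_comp_continuous {Ωδ : ℝ → Type*} [∀ δ, MeasurableSpace (Ωδ δ)] {Ω' : Type*}
    [MeasurableSpace Ω'] {X Y : Type*} [TopologicalSpace X] [TopologicalSpace Y]
    {Z : ∀ δ, Ωδ δ → X} {P : ∀ δ, Measure (Ωδ δ)} {W : Ω' → X} {P' : Measure Ω'}
    (h : TendstoLaw Z P W P') (g : C(X, Y)) :
    TendstoLaw (fun δ ω => g (Z δ ω)) P (fun ω => g (W ω)) P' := by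
  intro f
  simpa only [BoundedContinuousFunction.compContinuous_apply] using h (f.compContinuous g)

/-- **The quarter turn transports convergence in law of the critical SAW.** Under the exact
lattice symmetry `SAWBrickWallHomotopy.QuarterTurnCovariance` (first clause: the critical SAW law
of `Ω_δ` pushed to curves and rotated by `R : z ↦ i z` is the critical SAW law of `(RΩ)_δ` between
the rotated sites, pushed to curves), if the SAW curves of `Ω` from `a_δ` to `b_δ` converge in law
to `W`, then the SAW curves of `R Ω` from `R a_δ` to `R b_δ` converge in law to `R ∘ W`
(`integral_map` twice and `tendstoLaw_comp_continuous`). [folklore] -/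
theorem tendstoLaw_quarterTurn (hQ : SAWBrickWallHomotopy.QuarterTurnCovariance) {Ω : Set ℂ}
    {a b : ℝ → Site 2} {Ω' : Type*} [MeasurableSpace Ω'] {W : Ω' → CurveClass ℂ}
    {P' : Measure Ω'}
    (h : TendstoLaw (fun δ (γ : SAW.DomainSAW Ω δ (a δ) (b δ)) => γ.curve)
      (fun δ => SAW.law Ω δ (a δ) (b δ)) W P') :
    TendstoLaw
      (fun δ (γ : SAW.DomainSAW ((similarity Complex.I Complex.I_ne_zero 0) '' Ω) δ
        ![-(a δ 1), a δ 0] ![-(b δ 1), b δ 0]) => γ.curve)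
      (fun δ => SAW.law ((similarity Complex.I Complex.I_ne_zero 0) '' Ω) δ
        ![-(a δ 1), a δ 0] ![-(b δ 1), b δ 0])
      (fun ω => CurveClass.map (similarity Complex.I Complex.I_ne_zero 0 : C(ℂ, ℂ)) (W ω)) P' := by
  intro f
  have hT := tendstoLaw_comp_continuous h
    ⟨CurveClass.map (similarity Complex.I Complex.I_ne_zero 0 : C(ℂ, ℂ)), CurveClass.continuous_map _⟩ f
  refine hT.congr fun δ => ?_
  have h1 := hQ.1 Ω δ (a δ) (b δ)
  rw [Measure.map_map (CurveClass.measurable_map _) (SAW.DomainSAW.measurable_of_top _)] at h1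
  calc ∫ γ, f (CurveClass.map (similarity Complex.I Complex.I_ne_zero 0 : C(ℂ, ℂ)) γ.curve)
        ∂(SAW.law Ω δ (a δ) (b δ))
      = ∫ x, f x ∂((SAW.law Ω δ (a δ) (b δ)).map
          (CurveClass.map (similarity Complex.I Complex.I_ne_zero 0 : C(ℂ, ℂ)) ∘
            fun γ => γ.curve)) :=
        (integral_map (SAW.DomainSAW.measurable_of_top _).aemeasurable
          f.continuous.aestronglyMeasurable).symm
    _ = ∫ x, f x ∂((SAW.law ((similarity Complex.I Complex.I_ne_zero 0) '' Ω) δ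
          ![-(a δ 1), a δ 0] ![-(b δ 1), b δ 0]).map fun γ => γ.curve) := by rw [h1]
    _ = ∫ γ, f γ.curve ∂(SAW.law ((similarity Complex.I Complex.I_ne_zero 0) '' Ω) δ
          ![-(a δ 1), a δ 0] ![-(b δ 1), b δ 0]) :=
        integral_map (SAW.DomainSAW.measurable_of_top _).aemeasurable
          f.continuous.aestronglyMeasurable

/-! ### Functoriality of `CurveClass.map` along `Φ⁻¹ ∘ R ∘ Φ` -/

/-- `Φ⁻¹ ∘ (ψ ∘ (Φ ∘ Γ)) = (Φ.trans (ψ.trans Φ.symm)) ∘ Γ` on curve classes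
(`CurveClass.map_homeomorph_trans` twice). [folklore] -/
theorem curveClassMap_symm_comp_comp (Φ ψ : ℂ ≃ₜ ℂ) {Ω' : Type*} (Γ : Ω' → CurveClass ℂ) :
    (CurveClass.map (Φ.symm : C(ℂ, ℂ)) ∘ fun ω =>
        CurveClass.map (ψ : C(ℂ, ℂ)) (CurveClass.map (Φ : C(ℂ, ℂ)) (Γ ω))) =
      CurveClass.map ((Φ.trans (ψ.trans Φ.symm) : ℂ ≃ₜ ℂ) : C(ℂ, ℂ)) ∘ Γ := by
  rw [CurveClass.map_homeomorph_trans, CurveClass.map_homeomorph_trans]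
  rfl

/-- `Φ⁻¹ ∘ (Φ ∘ Γ) = Γ` on curve classes (`CurveClass.map_homeomorph_trans`,
`Homeomorph.self_trans_symm`, `CurveClass.map_homeomorph_refl`). [folklore] -/
theorem curveClassMap_symm_comp (Φ : ℂ ≃ₜ ℂ) {Ω' : Type*} (Γ : Ω' → CurveClass ℂ) :
    (CurveClass.map (Φ.symm : C(ℂ, ℂ)) ∘ fun ω => CurveClass.map (Φ : C(ℂ, ℂ)) (Γ ω)) = Γ := by
  funext ω
  change (CurveClass.map (Φ.symm : C(ℂ, ℂ)) ∘ CurveClass.map (Φ : C(ℂ, ℂ))) (Γ ω) = Γ ω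
  rw [← CurveClass.map_homeomorph_trans, Homeomorph.self_trans_symm, CurveClass.map_homeomorph_refl]
  rfl

/-! ### The stub -/

/-- **Registered stub `stub_conjugateRotationCovariance`** (crux item stmt-CriticalPhenomena-14221,
line `pin-the-shear`). For ONE plane homeomorphism `Φ`: if the critical `δℤ²` SAW law of every
Dobrushin domain `D` converges in law to `Φ ∘ Γ_D`, `Γ_D` an SLE(8/3) curve of `Φ⁻¹(D)` (image
limit), and the quarter turn `R : z ↦ i z` is an exact symmetry of the critical `δℤ²` SAW
(`SAWBrickWallHomotopy.QuarterTurnCovariance`), then `Ψ := Φ.trans (R.trans Φ.symm)` (the map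
`Φ⁻¹ ∘ R ∘ Φ`) sends every chordal SLE(8/3) law to a chordal SLE(8/3) law. Proof: image limits at
`Φ(D)` and at `R Φ(D)` (endpoint approximation from `SAW.exists_isEndpointApprox`, rotated by the
second clause of the symmetry), transport of the first along `R` (`tendstoLaw_quarterTurn`),
uniqueness of weak limits (`TendstoLaw.map_eq`, Billingsley Thm 1.2) and uniqueness in law of
chordal SLE (`IsSLECurve.map_eq_holds`). [folklore] -/
theorem stub_conjugateRotationCovariance :
    ∀ Φ : ℂ ≃ₜ ℂ,
      (∀ (D : DobrushinDomain) (a b : ℝ → Site 2), SAW.IsEndpointApprox D a b →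
        ∃ Γ : (ℝ≥0 → ℝ) → CurveClass ℂ, IsSLECurve ((8 : ℝ≥0) / 3) (D.map Φ.symm) Γ ∧
          TendstoLaw (fun δ (γ : SAW.DomainSAW D.carrier δ (a δ) (b δ)) => γ.curve)
            (fun δ => SAW.law D.carrier δ (a δ) (b δ))
            (fun ω => CurveClass.map (Φ : C(ℂ, ℂ)) (Γ ω)) Process.preWienerMeasure) →
      SAWBrickWallHomotopy.QuarterTurnCovariance →
      ∀ (D : DobrushinDomain) (μ : Measure (CurveClass ℂ)), IsSLELaw ((8 : ℝ≥0) / 3) D μ →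
        IsSLELaw ((8 : ℝ≥0) / 3)
          (D.map (Φ.trans ((similarity Complex.I Complex.I_ne_zero 0).trans Φ.symm)))
          (μ.map (CurveClass.map
            ((Φ.trans ((similarity Complex.I Complex.I_ne_zero 0).trans Φ.symm) : ℂ ≃ₜ ℂ) :
              C(ℂ, ℂ)))) := by
  intro Φ hIL hQ D μ hμ
  haveI := isProbabilityMeasure_preWienerMeasure'
  obtain ⟨Γ', hΓ', rfl⟩ := hμ
  -- the image limit at `Φ(D)`: an SLE(8/3) curve `Γ` of `Φ⁻¹(Φ(D)) = D`
  obtain ⟨a, b, hab⟩ := SAW.exists_isEndpointApprox (D.map Φ)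
  obtain ⟨Γ, hΓ, T₁⟩ := hIL (D.map Φ) a b hab
  rw [MarkedDomain.map_map, Homeomorph.self_trans_symm, MarkedDomain.map_refl] at hΓ
  -- the image limit at `R Φ(D)` for the rotated endpoint approximation: an SLE(8/3) curve `Γ₂`
  -- of `Φ⁻¹(R(Φ(D))) = Ψ(D)`
  obtain ⟨Γ₂, hΓ₂, T₂⟩ := hIL ((D.map Φ).map (similarity Complex.I Complex.I_ne_zero 0))
    (fun δ => ![-(a δ 1), a δ 0]) (fun δ => ![-(b δ 1), b δ 0]) (hQ.2 (D.map Φ) a b hab)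
  rw [MarkedDomain.map_map, MarkedDomain.map_map] at hΓ₂
  -- transport the first limit along `R`
  have T₁' := tendstoLaw_quarterTurn hQ T₁
  -- uniqueness of weak limits: `law (R ∘ Φ ∘ Γ) = law (Φ ∘ Γ₂)`
  have hZ₁ : AEMeasurable (fun ω => CurveClass.map (similarity Complex.I Complex.I_ne_zero 0 :
      C(ℂ, ℂ)) (CurveClass.map (Φ : C(ℂ, ℂ)) (Γ ω))) Process.preWienerMeasure :=
    (CurveClass.measurable_map _).comp_aemeasurable
      ((CurveClass.measurable_map _).comp_aemeasurable hΓ.aemeasurable)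
  have hZ₂ : AEMeasurable (fun ω => CurveClass.map (Φ : C(ℂ, ℂ)) (Γ₂ ω))
      Process.preWienerMeasure :=
    (CurveClass.measurable_map _).comp_aemeasurable hΓ₂.aemeasurable
  have hlaw := T₁'.map_eq T₂ hZ₁ hZ₂
  -- apply `Φ⁻¹`: `law (Ψ ∘ Γ) = law Γ₂`
  have hlaw' := congrArg
    (fun ν : Measure (CurveClass ℂ) => ν.map (CurveClass.map (Φ.symm : C(ℂ, ℂ)))) hlaw
  rw [AEMeasurable.map_map_of_aemeasurable (CurveClass.measurable_map _).aemeasurable hZ₁,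
    AEMeasurable.map_map_of_aemeasurable (CurveClass.measurable_map _).aemeasurable hZ₂,
    curveClassMap_symm_comp_comp, curveClassMap_symm_comp] at hlaw'
  -- `μ = law Γ' = law Γ` (uniqueness in law of chordal SLE), and conclude
  refine ⟨Γ₂, hΓ₂, ?_⟩
  rw [IsSLECurve.map_eq_holds hΓ' hΓ,
    AEMeasurable.map_map_of_aemeasurable (CurveClass.measurable_map _).aemeasurable hΓ.aemeasurable]
  exact hlaw'

end Summit.CriticalPhenomena.SAWScalingLimit.Cruxes.HexTransfer.PinTheShear

end
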